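import Mathlib.Analysis.SpecialFunctions.JapaneseBracket
import Literature.Analysis.FluidPDE.TypeIAncientMild
import Literature.Analysis.FluidPDE.KatoLocalBoundedPicard
import Literature.Analysis.FluidPDE.OseenMildUniqueness
import Literature.Analysis.FluidPDE.ChaeWolfRemovingDSSLimit
import Literature.Analysis.FluidPDE.NSLerayBlowupRateLpProofs
import Summits.NavierStokesRegularity.NavierStokesRegularity.Theorems.QuantisedSymmetryPolyhedralDssProfileExistsStubCellOfRepresentative
import Summits.NavierStokesRegularity.NavierStokesRegularity.Theorems.QuantisedSymmetryPolyhedralDssProfileExistsStubCellConcatenation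
import Summits.NavierStokesRegularity.NavierStokesRegularity.Theorems.QuantisedSymmetryPolyhedralDssProfileExistsStubDssL4Propagation
import HarnessLib

/-!
# No small slice — crux stmt-NavierStokesRegularity-1404
  (`QuantisedSymmetry.PolyhedralDssProfileExists`), line polyhedral_cell,
  stub stub_noSmallSlice (N5)

Registered necessary condition `stub_noSmallSlice` (`--supports stmt-NavierStokesRegularity-1404`):
there is a universal `ε₁ > 0` such that an Oseen-gauge Type-I field `V` (`IsTypeIAncientMild C V`)
which is exactly `c`-DSS (`c > 1`) and has a Type-I space–time bound (`HasTypeIDecay C₀ V`)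
vanishes identically on the past as soon as ONE slice is small in the scale-invariant sup norm,
`√(-t₁) ‖V(t₁, x)‖ ≤ ε₁` for all `x`.

Proof.
* `ε₁ = 1/(16 K)`, `K` the constant of Oseen's bounded Picard scheme
  `exists_oseen_fixedPoint_bounded` (Lemarié-Rieusset 2016, Thm 5.1 / proof of Thm 9.12) at
  `p = 4`, `ν = 1`: from the datum `a = V(s)` (continuous, `|a| ≤ A = ε₁/√(-s)`, in `L⁴` by the
  space–time bound, `noSmallSlice_memLp_four`) on the window `T = -s` the smallness condition reads
  `K · A · 2√T = 2 K ε₁ ≤ 1/8`, independently of `s`; the scheme yields a solution `W` of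
  `W(τ) = e^{τΔ}V(s) - B¹₀(W,W)(τ)` on `(0, -s)`, bounded by `2A` — it lives up to the blow-up time.
* `noSmallSlice_bound_of_fixedPoint`: the translate `τ ↦ V(τ + s)` solves the same equation
  (time covariance of the Duhamel term, `oseenDuhamel_comp_add_right`), so by uniqueness of
  bounded solutions (`oseenMild_bounded_unique`, KNSS 2009 §4) `V(t) = W(t - s)` a.e. for
  `t ∈ (s, 0)`, and by continuity of the slices (`forall_norm_le_of_ae_norm_le`)
  `‖V(t, x)‖ ≤ 2A` for ALL `x` and all `t ∈ [s, 0)`.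
* `noSmallSlice_eq_zero_of_bounded`: the zoom images `V(t/c²ᵏ, x/cᵏ) = cᵏ V(t, x)`
  (`ChaeWolf.isDiscretelySelfSimilar_pow`, `noSmallSlice_zoom`) of a point of the slab
  `[s, 0) × ℝ³` stay in the slab, so a bounded exactly `c`-DSS field vanishes there.
* The smallness is scale invariant (`noSmallSlice_small_pow`): it holds at every `(c²)ⁿ t₁`, and
  every `t < 0` lies above one of these times; hence `V(t) = 0`.
-/

noncomputable section

-- the summit namespace `…NavierStokesRegularity.NavierStokesRegularity…` is the tree convention (D-0017)
set_option linter.dupNamespace false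

namespace Summit.NavierStokesRegularity.NavierStokesRegularity.Theorems.PolyhedralDssProfileExists.PolyhedralCell

open MeasureTheory Set Function Filter Topology
open Literature.Analysis Literature.Analysis.FluidPDE

/-! ### The datum is in `L⁴` -/

/-- **Slices of a field with a Type-I space–time bound are in `L⁴(ℝ³)`**: for `s < 0`,
`‖V(s, x)‖ ≤ C₀/(‖x‖ + √(-s)) ≤ (C₀/m)(1 + ‖x‖)⁻¹`, `m = min 1 √(-s)`, and `(1 + ‖x‖)⁻⁴ ∈ L¹(ℝ³)`
(`integrable_one_add_norm`, `4 > 3`). [folklore] -/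
theorem noSmallSlice_memLp_four {C₀ : ℝ}
    {V : ℝ → EuclideanSpace ℝ (Fin 3) → EuclideanSpace ℝ (Fin 3)} (hdec : HasTypeIDecay C₀ V)
    {s : ℝ} (hs : s < 0) (hcont : Continuous (V s)) : MemLp (V s) 4 volume := by
  have hT : 0 < Real.sqrt (-s) := Real.sqrt_pos.2 (neg_pos.2 hs)
  have hC₀ : 0 ≤ C₀ := by
    by_contra hneg
    have hneg' : C₀ < 0 := not_le.1 hneg
    have h := hdec s hs 0
    rw [norm_zero, zero_add] at h
    have : C₀ / Real.sqrt (-s) < 0 := div_neg_of_neg_of_pos hneg' hT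
    linarith [norm_nonneg (V s 0)]
  set m : ℝ := min 1 (Real.sqrt (-s)) with hm
  have hm0 : 0 < m := lt_min one_pos hT
  have hm1 : m ≤ 1 := min_le_left _ _
  have hms : m ≤ Real.sqrt (-s) := min_le_right _ _
  have hbound : ∀ x, ‖V s x‖ ≤ C₀ / m / (‖x‖ + 1) := by
    intro x
    rw [div_div]
    refine (hdec s hs x).trans (div_le_div_of_nonneg_left hC₀ (mul_pos hm0 (by positivity)) ?_)
    calc m * (‖x‖ + 1) = m * ‖x‖ + m := by ring
      _ ≤ ‖x‖ + Real.sqrt (-s) := add_le_add (mul_le_of_le_one_left (norm_nonneg x) hm1) hms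
  have hdom : Integrable
      (fun x : EuclideanSpace ℝ (Fin 3) => (C₀ / m) ^ 4 * (1 + ‖x‖) ^ (-(4 : ℝ))) volume :=
    (integrable_one_add_norm (by rw [finrank_euclideanSpace_fin]; norm_num)).const_mul _
  rw [← integrable_norm_rpow_iff hcont.aestronglyMeasurable (by norm_num) ENNReal.ofNat_ne_top,
    ENNReal.toReal_ofNat]
  refine hdom.mono'
    ((hcont.norm.rpow_const fun _ => Or.inr (by norm_num)).aestronglyMeasurable)
    (Eventually.of_forall fun x => ?_)
  show ‖‖V s x‖ ^ (4 : ℝ)‖ ≤ (C₀ / m) ^ 4 * (1 + ‖x‖) ^ (-(4 : ℝ))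
  rw [Real.norm_of_nonneg (Real.rpow_nonneg (norm_nonneg _) _), Real.rpow_ofNat,
    Real.rpow_neg (by positivity), Real.rpow_ofNat, add_comm (1 : ℝ), ← div_eq_mul_inv,
    ← div_pow]
  exact pow_le_pow_left₀ (norm_nonneg _) (hbound x) 4

/-! ### Scale invariance of the smallness and the zoom -/

/-- **The scale-invariant smallness propagates one zoom into the past**: for an exactly `c`-DSS
field, `√(-s)‖V(s, ·)‖_∞ ≤ ε` implies `√(-c²s)‖V(c²s, ·)‖_∞ ≤ ε`
(`V(s, y/c) = c V(c²s, y)`). [folklore] -/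
theorem noSmallSlice_small_sq_mul {c : ℝ} (hc : 0 < c)
    {V : ℝ → EuclideanSpace ℝ (Fin 3) → EuclideanSpace ℝ (Fin 3)}
    (hdss : IsDiscretelySelfSimilar c V) {ε s : ℝ} (h : ∀ x, Real.sqrt (-s) * ‖V s x‖ ≤ ε)
    (y : EuclideanSpace ℝ (Fin 3)) : Real.sqrt (-(c ^ 2 * s)) * ‖V (c ^ 2 * s) y‖ ≤ ε := by
  have key : c • V (c ^ 2 * s) y = V s (c⁻¹ • y) := by
    have := congrFun (congrFun hdss s) (c⁻¹ • y)
    rwa [nsRescale_apply, smul_inv_smul₀ hc.ne'] at this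
  have hn : c * ‖V (c ^ 2 * s) y‖ = ‖V s (c⁻¹ • y)‖ := by
    have := congrArg norm key
    rwa [norm_smul, Real.norm_of_nonneg hc.le] at this
  have hsq : Real.sqrt (-(c ^ 2 * s)) = c * Real.sqrt (-s) := by
    rw [show -(c ^ 2 * s) = c ^ 2 * (-s) by ring, Real.sqrt_mul (sq_nonneg c), Real.sqrt_sq hc.le]
  calc Real.sqrt (-(c ^ 2 * s)) * ‖V (c ^ 2 * s) y‖
      = Real.sqrt (-s) * (c * ‖V (c ^ 2 * s) y‖) := by rw [hsq]; ring
    _ = Real.sqrt (-s) * ‖V s (c⁻¹ • y)‖ := by rw [hn]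
    _ ≤ ε := h _

/-- The scale-invariant smallness at `s` propagates to all the zoomed times `(c²)ᵏ s`, `k : ℕ`.
[folklore] -/
theorem noSmallSlice_small_pow {c : ℝ} (hc : 0 < c)
    {V : ℝ → EuclideanSpace ℝ (Fin 3) → EuclideanSpace ℝ (Fin 3)}
    (hdss : IsDiscretelySelfSimilar c V) {ε s : ℝ} (h : ∀ x, Real.sqrt (-s) * ‖V s x‖ ≤ ε)
    (k : ℕ) : ∀ y, Real.sqrt (-((c ^ 2) ^ k * s)) * ‖V ((c ^ 2) ^ k * s) y‖ ≤ ε := by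
  induction k with
  | zero => simpa only [pow_zero, one_mul] using h
  | succ k ih =>
      have e : (c ^ 2) ^ (k + 1) * s = c ^ 2 * ((c ^ 2) ^ k * s) := by ring
      rw [e]
      exact noSmallSlice_small_sq_mul hc hdss ih

/-- **The zoom towards the origin**: for an exactly `d`-DSS field (`d > 0`),
`V(t/d², x/d) = d V(t, x)`. [folklore] -/
theorem noSmallSlice_zoom {d : ℝ} (hd : 0 < d)
    {V : ℝ → EuclideanSpace ℝ (Fin 3) → EuclideanSpace ℝ (Fin 3)}
    (hdss : IsDiscretelySelfSimilar d V) (t : ℝ) (x : EuclideanSpace ℝ (Fin 3)) :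
    V (t / d ^ 2) (d⁻¹ • x) = d • V t x := by
  have := congrFun (congrFun hdss (t / d ^ 2)) (d⁻¹ • x)
  rw [nsRescale_apply, mul_div_cancel₀ _ (by positivity : d ^ 2 ≠ 0), smul_inv_smul₀ hd.ne']
    at this
  exact this.symm

/-- **A bounded exactly `c`-DSS field vanishes** (`c > 1`): if `‖V(t, x)‖ ≤ B` on the slab
`[s, 0) × ℝ³`, then `V = 0` there — the zoom images `V(t/c²ᵏ, x/cᵏ) = cᵏ V(t, x)` of a point of
the slab stay in the slab while `cᵏ → ∞`. [folklore] -/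
theorem noSmallSlice_eq_zero_of_bounded {c : ℝ} (hc : 1 < c)
    {V : ℝ → EuclideanSpace ℝ (Fin 3) → EuclideanSpace ℝ (Fin 3)}
    (hdss : IsDiscretelySelfSimilar c V) {s B : ℝ} (hB : ∀ t ∈ Ico s 0, ∀ x, ‖V t x‖ ≤ B) :
    ∀ t ∈ Ico s 0, ∀ x, V t x = 0 := by
  intro t ht x
  by_contra hne
  have hpos : 0 < ‖V t x‖ := norm_pos_iff.2 hne
  obtain ⟨k, hk⟩ := pow_unbounded_of_one_lt (B / ‖V t x‖) hc
  have hd : 0 < c ^ k := pow_pos (one_pos.trans hc) k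
  have hd1 : (1 : ℝ) ≤ (c ^ k) ^ 2 := one_le_pow₀ (one_le_pow₀ hc.le)
  -- the zoomed time stays in the slab
  have hmem : t / (c ^ k) ^ 2 ∈ Ico s 0 := by
    refine ⟨?_, div_neg_of_neg_of_pos ht.2 (by positivity)⟩
    rw [le_div_iff₀ (by positivity)]
    have h1 : s * (c ^ k) ^ 2 ≤ s * 1 := mul_le_mul_of_nonpos_left hd1 (ht.1.trans ht.2.le)
    linarith [ht.1]
  have key := hB _ hmem ((c ^ k)⁻¹ • x)
  rw [noSmallSlice_zoom hd (ChaeWolf.isDiscretelySelfSimilar_pow hdss k), norm_smul,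
    Real.norm_of_nonneg hd.le] at key
  have hle : c ^ k ≤ B / ‖V t x‖ := by rw [le_div_iff₀ hpos]; exact key
  linarith

/-! ### Kato's solution lives up to the blow-up time: the sup bound on `(s, 0)` -/

/-- **Identification with Oseen's bounded Picard solution.** Let `V` be an Oseen-gauge Type-I
field and let `W` be a jointly measurable field on `(0, -s) × ℝ³` (`s < 0`), bounded by `2A`,
solving `W(τ) = e^{τΔ}V(s) - B¹₀(W,W)(τ)` pointwise (the output of
`exists_oseen_fixedPoint_bounded` from the datum `V(s)` on the window `T = -s`). Then
`‖V(t, x)‖ ≤ 2A` for all `t ∈ (s, 0)` and all `x`: the translate `τ ↦ V(τ + s)` solves the same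
integral equation on every `(0, T')`, `T' < -s`, where both fields are bounded, so the two agree
a.e. by uniqueness of bounded solutions (`oseenMild_bounded_unique`), and the slices of `V` are
continuous. [cite: LemarieRieusset2016, Thm 5.1 and Thm 9.12] -/
theorem noSmallSlice_bound_of_fixedPoint {C : ℝ}
    {V : ℝ → EuclideanSpace ℝ (Fin 3) → EuclideanSpace ℝ (Fin 3)} (hV : IsTypeIAncientMild C V)
    {s A : ℝ} (hA : 0 < A) {W : ℝ → EuclideanSpace ℝ (Fin 3) → EuclideanSpace ℝ (Fin 3)}
    (hWm : AEStronglyMeasurable (uncurry W)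
      ((volume : Measure (ℝ × EuclideanSpace ℝ (Fin 3))).restrict (Ioo 0 (-s) ×ˢ univ)))
    (hWb : ∀ τ ∈ Ioo 0 (-s), ∀ x, ‖W τ x‖ ≤ 2 * A)
    (hWeq : ∀ τ ∈ Ioo 0 (-s), ∀ x,
      W τ x = UnboundedOperators.heatExtension (V s) (1 * τ) x - oseenDuhamel 1 0 W W τ x) :
    ∀ t ∈ Ioo s 0, ∀ x, ‖V t x‖ ≤ 2 * A := by
  intro t ht
  -- the window `(0, T')` in the translated frame, `t - s < T' < -s`
  set T' : ℝ := t / 2 - s with hT'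
  have h1 : t - s < T' := by rw [hT']; linarith [ht.2]
  have h2 : T' < -s := by rw [hT']; linarith [ht.2]
  have hTs : T' + s < 0 := by rw [hT']; linarith [ht.2]
  -- the translate `v τ = V (τ + s)`
  set v : ℝ → EuclideanSpace ℝ (Fin 3) → EuclideanSpace ℝ (Fin 3) := fun τ => V (τ + s) with hv_def
  have hv_apply : ∀ τ x, v τ x = V (τ + s) x := fun τ x => rfl
  -- the common bound on `(0, T')`
  set M : ℝ := max (2 * A) (C / Real.sqrt (-(T' + s))) with hM
  have hM0 : 0 ≤ M := le_max_of_le_left (by positivity)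
  have hvM : ∀ τ ∈ Ioo 0 T', ∀ y, ‖v τ y‖ ≤ M := fun τ hτ y =>
    (hV.norm_le_of_mem_Ioo (s := s) hTs ⟨by linarith [hτ.1], by linarith [hτ.2]⟩ y).trans
      (le_max_right _ _)
  have hWM : ∀ τ ∈ Ioo 0 T', ∀ y, ‖W τ y‖ ≤ M := fun τ hτ y =>
    (hWb τ ⟨hτ.1, hτ.2.trans h2⟩ y).trans (le_max_left _ _)
  -- joint measurability on the slab `(0, T') × ℝ³`
  have hWm' : AEStronglyMeasurable (uncurry W)
      ((volume : Measure (ℝ × EuclideanSpace ℝ (Fin 3))).restrict (Ioo 0 T' ×ˢ univ)) :=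
    hWm.mono_set (prod_mono (Ioo_subset_Ioo_right h2.le) subset_rfl)
  have hvm : AEStronglyMeasurable (uncurry v)
      ((volume : Measure (ℝ × EuclideanSpace ℝ (Fin 3))).restrict (Ioo 0 T' ×ˢ univ)) := by
    have e : uncurry v = uncurry V ∘ fun z : ℝ × EuclideanSpace ℝ (Fin 3) => (z.1 + s, z.2) := by
      funext ⟨τ, x⟩; rfl
    rw [e]
    refine (hV.continuousOn_uncurry.comp (by fun_prop) fun z hz => ⟨?_, mem_univ _⟩)
      |>.aestronglyMeasurable (measurableSet_Ioo.prod MeasurableSet.univ)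
    show z.1 + s < 0
    linarith [hz.1.2]
  -- the two integral identities from the common free term `e^{τΔ} V(s)`
  have hWfix : ∀ τ ∈ Ioo 0 T', W τ =ᵐ[volume] fun x =>
      UnboundedOperators.heatExtension (V s) (1 * τ) x - oseenDuhamel 1 0 W W τ x :=
    fun τ hτ => Eventually.of_forall (hWeq τ ⟨hτ.1, hτ.2.trans h2⟩)
  have hvfix : ∀ τ ∈ Ioo 0 T', v τ =ᵐ[volume] fun x =>
      UnboundedOperators.heatExtension (V s) (1 * τ) x - oseenDuhamel 1 0 v v τ x := by
    intro τ hτ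
    refine Eventually.of_forall fun x => ?_
    beta_reduce
    have h := hV.mild_eq_heatExtension (s := s) (t := τ + s) (by linarith [hτ.1])
      (by linarith [hτ.2]) x
    rw [add_sub_cancel_right] at h
    have hB : oseenDuhamel 1 0 v v τ x = oseenDuhamel 1 s V V (τ + s) x := by
      rw [hv_def, oseenDuhamel_comp_add_right, zero_add]
    rw [hB, one_mul, hv_apply]
    exact h
  -- uniqueness of bounded solutions of the integral equation
  have hae : ∀ τ ∈ Ioo 0 T', W τ =ᵐ[volume] v τ :=
    oseenMild_bounded_unique
      (U := fun τ x => UnboundedOperators.heatExtension (V s) (1 * τ) x)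
      one_pos hM0 hWm' hvm hWM hvM hWfix hvfix
  -- at `τ = t - s`: `V t = W (t - s)` a.e., bounded by `2A` a.e., hence everywhere
  intro x
  have hτ : t - s ∈ Ioo 0 T' := ⟨by linarith [ht.1], h1⟩
  have hae_t : ∀ᵐ y ∂(volume : Measure (EuclideanSpace ℝ (Fin 3))), ‖V t y‖ ≤ 2 * A := by
    filter_upwards [hae (t - s) hτ] with y hy
    rw [hv_apply, sub_add_cancel] at hy
    rw [← hy]
    exact hWb (t - s) ⟨hτ.1, h1.trans h2⟩ y
  exact forall_norm_le_of_ae_norm_le (hV.continuous_slice ht.2) hae_t x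

/-! ### The registered necessary condition -/

/-- **REGISTERED NECESSARY CONDITION `stub_noSmallSlice` (N5): no small slice.** There is a
universal `ε₁ > 0` such that: if `V` is an Oseen-gauge Type-I field (`IsTypeIAncientMild C V`),
exactly `c`-DSS (`c > 1`), with a Type-I space–time bound `HasTypeIDecay C₀ V`, and ONE slice is
small in the scale-invariant sup norm, `√(-t₁) ‖V(t₁, x)‖ ≤ ε₁` for all `x`, then `V ≡ 0` on the
past. Proof: `ε₁ = 1/(16K)` with `K` the constant of Oseen's bounded Picard scheme
(`exists_oseen_fixedPoint_bounded`, `p = 4`, `ν = 1`); given `t < 0`, the smallness holds at the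
zoomed time `s = (c²)ⁿ t₁ ≤ t` (`noSmallSlice_small_pow`); from the datum `V(s)`
(`|V(s)| ≤ A = ε₁/√(-s)`, `V(s) ∈ L⁴` by `noSmallSlice_memLp_four`) on the window `T = -s` the
smallness condition `K A · 2√T = 2Kε₁ ≤ 1/8` holds independently of `s`, so Kato's solution lives
on `(0, -s)` bounded by `2A`, hence `‖V‖ ≤ 2A` on `[s, 0) × ℝ³`
(`noSmallSlice_bound_of_fixedPoint`), and a bounded exactly DSS field vanishes on the slab
(`noSmallSlice_eq_zero_of_bounded`). Consequence for the crux: every slice of every witness has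
`√(-t)‖V(t)‖_∞ > ε₁`. [cite: LemarieRieusset2016, Thm 5.1 and Thm 9.12] -/
theorem stub_noSmallSlice :
    ∃ ε₁ : ℝ, 0 < ε₁ ∧ ∀ (c C C₀ : ℝ) (V : ℝ → EuclideanSpace ℝ (Fin 3) → EuclideanSpace ℝ (Fin 3)),
      1 < c → IsTypeIAncientMild C V → IsDiscretelySelfSimilar c V → HasTypeIDecay C₀ V →
      ∀ t₁ < 0, (∀ x, Real.sqrt (-t₁) * ‖V t₁ x‖ ≤ ε₁) → ∀ t < 0, ∀ x, V t x = 0 := by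
  obtain ⟨K, hK, hscheme⟩ :=
    exists_oseen_fixedPoint_bounded (E := EuclideanSpace ℝ (Fin 3)) (p := 4) (by norm_num)
      (by norm_num)
  refine ⟨1 / (16 * K), by positivity, ?_⟩
  intro c C C₀ V hc hV hdss hdec t₁ ht₁ hsmall t ht x
  have hc0 : 0 < c := one_pos.trans hc
  have hq : 1 < c ^ 2 := by nlinarith
  -- a small slice below `t`: `s = (c²)ⁿ t₁ < t`
  obtain ⟨n, hn⟩ := pow_unbounded_of_one_lt (t / t₁) hq
  set s : ℝ := (c ^ 2) ^ n * t₁ with hs_def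
  have hs0 : s < 0 := mul_neg_of_pos_of_neg (pow_pos (by positivity) n) ht₁
  have hst : s < t := by
    have := mul_lt_mul_of_neg_right hn ht₁
    rwa [div_mul_cancel₀ _ ht₁.ne] at this
  have hsm : ∀ y, Real.sqrt (-s) * ‖V s y‖ ≤ 1 / (16 * K) :=
    noSmallSlice_small_pow hc0 hdss hsmall n
  -- Oseen's scheme from the datum `V s` on the window `T = -s`, `A = ε₁ / √(-s)`
  have hT : 0 < Real.sqrt (-s) := Real.sqrt_pos.2 (neg_pos.2 hs0)
  set A : ℝ := 1 / (16 * K) / Real.sqrt (-s) with hA_def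
  have hA : 0 < A := by positivity
  have habd : ∀ y, ‖V s y‖ ≤ A := fun y => by
    rw [hA_def, le_div_iff₀ hT, mul_comm]
    exact hsm y
  have hKA : K * A * (1 : ℝ) ^ (-(1 / 2 : ℝ)) * (2 * Real.sqrt (-s)) ≤ 1 / 8 := by
    rw [Real.one_rpow, mul_one, hA_def]
    have e : K * (1 / (16 * K) / Real.sqrt (-s)) * (2 * Real.sqrt (-s)) = 1 / 8 := by
      field_simp
      ring
    exact e.le
  obtain ⟨W, hWm, hWb, -, -, hWeq⟩ := hscheme one_pos (neg_pos.2 hs0) hA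
    (hV.aestronglyMeasurable_slice hs0) habd
    (noSmallSlice_memLp_four hdec hs0 (hV.continuous_slice hs0)) hKA
  -- `V` is bounded by `2A` on `[s, 0) × ℝ³`
  have hbd : ∀ τ ∈ Ico s 0, ∀ y, ‖V τ y‖ ≤ 2 * A := by
    intro τ hτ y
    rcases hτ.1.eq_or_lt with h | h
    · rw [← h]
      linarith [habd y]
    · exact noSmallSlice_bound_of_fixedPoint hV hA hWm hWb hWeq τ ⟨h, hτ.2⟩ y
  exact noSmallSlice_eq_zero_of_bounded hc hdss hbd t ⟨hst.le, ht⟩ x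

end Summit.NavierStokesRegularity.NavierStokesRegularity.Theorems.PolyhedralDssProfileExists.PolyhedralCell

end
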